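/-
Copyright: lit-balaban Phase-2 proof seat p30 (gen 3).  Statement-level skeleton of a published paper; no proof claims beyond what
the kernel checks below.
-/
import Literature.MathematicalPhysics.QuantumFieldTheory.BalabanImbrieJaffe1984to88.BIJ85Eq531Proof
import Literature.MathematicalPhysics.QuantumFieldTheory.BalabanImbrieJaffe1984to88.BIJ85SigmaForm421

/-!
# `BalabanImbrieJaffe1984to88.BIJ85Sigma421Torus` — T. Bałaban, J. Imbrie, A. Jaffe, *Renormalization of the Higgs model: minimizers,
propagators and the stability of mean field theory*, Commun. Math. Phys. **97** (1985) 299–329 [BalabanImbrieJaffe1985]: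
the quadratic form **σ_k (4.2.1)–(4.2.2)** and **(4.3.1)–(4.3.2)** ON THE TORI of the series — the model instance of seat p09's
abstract `BIJ85SigmaForm421`, with the printed translation `A → A + Q^{s*}_kB` of (4.3.2) made concrete

statement-level skeleton of published theorems with citation tags; proofs where landed; nothing here is a claim about the Yang–Mills mass gap

PDF held: `paper:balaban1985-cmp97-bij-higgs-minimizers` (journal page = PDF page + 298).  Pages read as images: pp. 310–311
[PDF 12–13] (`run/shared/lean/pub/pub-balaban/t4/b2b-balaban-t4-lit2/renders/bij1985/1985-cmp97-bij-higgs-minimizers-p012-x2.png`,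
`…-p013-x2.png`).

CITATION HEADER (lean-in-tree rule).  Part of the lit-balaban TYPED SKELETON (HOME `run/shared/lean/pub/lit-balaban/`), Phase-2
seat p30 (gen 3); rows **C1.Eq4.2.1-4.2.2** and **C1.Eq4.3.1-4.3.3** ((4.3.2) part) of `HOME/SKELETON.md` — companion «model
instance» of seat p09's `BIJ85SigmaForm421` (which PROVES, for abstract Euclidean spaces `E` (η-bond fields), `F` (η-plaquette
fields), `F′` (unit plaquette fields), a constraint subspace `V`, a curl `D` and a `Q^{e*}_k : F′ → F`: the operator (4.2.2)
`σ_k = Q^e_k(I − ∂G_{k,Ax}∂^*)Q^{e*}_k` satisfies the defining identity (4.2.1), and `⟨f₀, σ_kf₀⟩ = ‖∂H_{k,Ax}B‖²` whenever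
`Q^{e*}_kf₀ = ∂A₀` for a representative `A₀` — the translation datum of (4.3.2) as a HYPOTHESIS).  THE PRINTED TEXT, p. 310–311,
verbatim: *"exp(−½⟨f, σ_kf⟩) = Z_{k,Ax}^{−1}∫𝒟Aδ(Q_kA)δ_{k,Ax}(A)exp(−½‖∂A − Q^{e*}_kf‖²). (4.2.1) Here f is any real (Lie algebra)
valued field defined on unit lattice plaquettes. … σ_k = Q^e_k(I − ∂G_{k,Ax}∂^*)Q^{e*}_k (4.2.2)"*; *"⟨∂B, σ_k∂B⟩ = ⟨B, Δ_kB⟩, (4.3.1)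
which defines an action Δ_k. To give a functional integral representation for Δ_k, we note that exp(−½⟨∂B, σ_k∂B⟩) =
Z_{k,Ax}^{−1}∫𝒟Aδ(Q_kA)δ_{k,Ax}(A)exp(−½‖∂A − Q^{e*}_k∂B‖²) = Z_{k,Ax}^{−1}∫𝒟Aδ(Q_kA − B)δ_{k,Ax}(A)exp(−½‖∂A‖²) = exp(−½⟨B, Δ_kB⟩).
(4.3.2) Here we have performed a translation of A on surface bonds A → A + Q^{s*}_kB. We use the fact that the axial gauge
condition is independent of the surface bonds, we use ∂Q^{s*}_k = Q^{e*}_k∂, and we also use (2.19)."*  WHAT IS DONE HERE, on the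
tori of `…Balaban1983to89.Setup` with the Euclidean encoding of seat p09 (`BondSpace P`, `PlaqSpace P`, `toE`, `curlOp w c` =
`√w·∂` with `w = η^d`, constraint subspace `V411 P k`, `torusHax`):
* §1 the unit-lattice plaquette space `UnitPlaqSpace P k` = `EuclideanSpace ℝ (Plaq P k)` and **`Q^{e*}_k` as a linear map**
  `QesOp hd w k : UnitPlaqSpace P k →ₗ PlaqSpace P`, `f ↦ √w·Q^{e*}_kf` with `Q^{e*}_k` = the k-fold composite `BIJ85Eq531Inputs.QestarIter`
  (linearity of the cell pull-back `Cells.Qstar`, `cellsQstar_add/_smul`, `QestarIter_add/_smul`), so that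
  `‖curlOp w c A − QesOp f‖² = Σ_p η^d|(∂A)(p) − (Q^{e*}_kf)(p)|²` is the printed `‖∂A − Q^{e*}_kf‖²` (`norm_sq_curlOp_sub_QesOp`);
* §2 **σ_k ON THE TORUS** `sigmaTorus hd w c k := sigmaOp (V411 P k) (curlOp w c) (QesOp hd w k)` and **(4.2.1) for it**
  (`isSigmaForm_sigmaTorus`, = p09's `isSigmaForm_sigmaOp` at the torus data; `0 ≤ ⟨f, σ_kf⟩ ≤ ‖Q^{e*}_kf‖²_η`, `sigmaTorus_form_bounds`);
* §3 **(4.3.1)–(4.3.2) ON THE TORUS with the printed representative**: for a unit-lattice bond field `B`, at `f₀ = ∂B` (unit-lattice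
  curl, factor `c/L^k`), `⟨∂B, σ_k∂B⟩ = Σ_pη^d|(∂H_{k,Ax}B)(p)|² = 2·curlAction w c (H_{k,Ax}B)` with `H_{k,Ax}B = torusHax w c k (Q^{s*}_kB)`
  (`sigmaTorus_curl`) — p09's hypothesis `Q^{e*}_kf₀ = ∂A₀` DISCHARGED by `A₀ = Q^{s*}_kB` and `∂Q^{s*}_k = Q^{e*}_k∂`
  (`BIJ85Eq531Inputs.curl_QsstarIter`, `QesOp_curl_eq`) — and `⟨∂B, σ_k∂B⟩ ≤ Σ_pη^d|(∂A)(p)|²` for every `A` with `Q_kA = B`,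
  `δ_{k,Ax}(A)` (`sigmaTorus_curl_le`; the translation `A − Q^{s*}_kB ∈ constraint411 k` of `BIJ85Eq531Inputs`); the value is the
  torus action `⟨B, Δ_kB⟩` of (4.3.1) (`deltaTorus`, `sigmaTorus_curl_eq_deltaTorus`).
Hypotheses as in p09's files: `w > 0`, the p. 309 no-zero-modes claim `hD`, standing range `k ≤ m + K`, `2 ≤ d`.  NOT here: the
second expression of (4.2.2) (needs (2.24) for the edge composites, seat p31), (4.2.3) (Sect. 7), (4.3.3)–(4.3.5).
Unit `lit-balaban-p30` (literature-prover-lit-balaban-p30-g3-0), 2026-08-21.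
-/

open scoped BigOperators RealInnerProductSpace

namespace Literature.MathematicalPhysics.QuantumFieldTheory.BalabanImbrieJaffe1984to88.BIJ85Sigma421Torus

open Literature.MathematicalPhysics.QuantumFieldTheory.Balaban1983to89
open LatticeFieldCalculus BIJ85CellAverages BIJ85Eq219Proof BIJ85CurlQsstar BIJ85Eq531Inputs BIJ85Eq531Proof
  BIJ85AxialPropagator411 BIJ85AxialMinimizer413 BIJ85SigmaForm421

variable {P : Params}

/-! ## 1. `Q^{e*}_k` as a linear map between the Euclidean plaquette spaces -/

/-- kernel: the cell pull-back (2.22)/(2.17)/(the adjoint of (2.6)) is additive (any cell geometry). [cite: BalabanImbrieJaffe1985, (2.22) p.305] -/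
theorem cellsQstar_add (G : Cells) (g₁ g₂ : G.C → ℝ) : G.Qstar (g₁ + g₂) = G.Qstar g₁ + G.Qstar g₂ := by
  funext p
  simp only [Cells.Qstar, Pi.add_apply, ← Finset.sum_add_distrib]
  refine Finset.sum_congr rfl fun c _ => ?_
  split_ifs <;> ring

/-- kernel: the cell pull-back is homogeneous (any cell geometry). [cite: BalabanImbrieJaffe1985, (2.22) p.305] -/
theorem cellsQstar_smul (G : Cells) (a : ℝ) (g : G.C → ℝ) : G.Qstar (a • g) = a • G.Qstar g := by
  funext p
  simp only [Cells.Qstar, Pi.smul_apply, smul_eq_mul, Finset.mul_sum]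
  refine Finset.sum_congr rfl fun c _ => ?_
  split_ifs <;> ring

/-- kernel: `Q^{e*}_k` (the composite `QestarIter`) is additive. [cite: BalabanImbrieJaffe1985, (2.24) p.305] -/
theorem QestarIter_add (hd : 2 ≤ P.d) : ∀ (k : ℕ) (g₁ g₂ : Plaq P k → ℝ),
    QestarIter hd k (g₁ + g₂) = QestarIter hd k g₁ + QestarIter hd k g₂
  | 0, _, _ => rfl
  | k + 1, g₁, g₂ => by rw [QestarIter_succ, QestarIter_succ, QestarIter_succ, cellsQstar_add, QestarIter_add hd k]

/-- kernel: `Q^{e*}_k` is homogeneous. [cite: BalabanImbrieJaffe1985, (2.24) p.305] -/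
theorem QestarIter_smul (hd : 2 ≤ P.d) : ∀ (k : ℕ) (a : ℝ) (g : Plaq P k → ℝ),
    QestarIter hd k (a • g) = a • QestarIter hd k g
  | 0, _, _ => rfl
  | k + 1, a, g => by rw [QestarIter_succ, QestarIter_succ, cellsQstar_smul, QestarIter_smul hd k]

/-- The unit-lattice (`T^{(k)}`) plaquette fields as a Euclidean space (pairing (2.20) with `a = 1`: `Σ_{p′} f_{p′}g_{p′}`), the `F′`
of p09's `BIJ85SigmaForm421`. [cite: BalabanImbrieJaffe1985, (2.20) p.305] -/
abbrev UnitPlaqSpace (P : Params) (k : ℕ) : Type := EuclideanSpace ℝ (Plaq P k)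

/-- The identification of a unit-lattice plaquette field with the vector of `UnitPlaqSpace`. [folklore] -/
noncomputable def toU (P : Params) (k : ℕ) : (Plaq P k → ℝ) ≃ₗ[ℝ] UnitPlaqSpace P k :=
  (WithLp.linearEquiv 2 ℝ (Plaq P k → ℝ)).symm

/-- The identification of an η-lattice plaquette field with the vector of p09's `PlaqSpace`. [folklore] -/
noncomputable def toP (P : Params) : (Plaq P 0 → ℝ) ≃ₗ[ℝ] PlaqSpace P :=
  (WithLp.linearEquiv 2 ℝ (Plaq P 0 → ℝ)).symm

/-- Components are unchanged by `toU`. [folklore] -/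
@[simp] private theorem toU_apply (k : ℕ) (f : Plaq P k → ℝ) (p : Plaq P k) : toU P k f p = f p := rfl

/-- Components are unchanged by `toU⁻¹`. [folklore] -/
@[simp] private theorem toU_symm_apply (k : ℕ) (f : UnitPlaqSpace P k) (p : Plaq P k) : (toU P k).symm f p = f p := rfl

/-- Components are unchanged by `toP`. [folklore] -/
@[simp] private theorem toP_apply (F : Plaq P 0 → ℝ) (p : Plaq P 0) : toP P F p = F p := rfl

/-- Components of p09's weighted curl `curlOp w c = √w·∂`. [folklore] -/
private theorem curlOp_apply' (w c : ℝ) (v : BondSpace P) (p : Plaq P 0) :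
    curlOp (P := P) w c v p = Real.sqrt w * curl c ((toE P).symm v) p := rfl

/-- `Q^{e*}_k` as a linear map on plaquette FIELDS (the composite `QestarIter` bundled). [cite: BalabanImbrieJaffe1985, (2.24) p.305] -/
noncomputable def QestarLin (hd : 2 ≤ P.d) (k : ℕ) : (Plaq P k → ℝ) →ₗ[ℝ] (Plaq P 0 → ℝ) where
  toFun := QestarIter hd k
  map_add' := QestarIter_add hd k
  map_smul' := QestarIter_smul hd k

/-- **`Q^{e*}_k` in (4.2.1)** as the linear map `F′ → F` of p09's setting ON THE TORUS: `f ↦ √w·Q^{e*}_kf`, `w = η^d` — the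
η-plaquette vectors carry the factor `√w` so that Euclidean norms are the printed η-lattice norms (as in p09's `curlOp w c = √w·∂`).
[cite: BalabanImbrieJaffe1985, (4.2.1) p.310] -/
noncomputable def QesOp (hd : 2 ≤ P.d) (w : ℝ) (k : ℕ) : UnitPlaqSpace P k →ₗ[ℝ] PlaqSpace P :=
  (toP P).toLinearMap ∘ₗ (Real.sqrt w • QestarLin (P := P) hd k) ∘ₗ (toU P k).symm.toLinearMap

/-- Components of `QesOp`: `(QesOp f)(p) = √w·(Q^{e*}_kf)(p)`. [cite: BalabanImbrieJaffe1985, (4.2.1) p.310] -/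
theorem QesOp_apply (hd : 2 ≤ P.d) (w : ℝ) (k : ℕ) (f : UnitPlaqSpace P k) (p : Plaq P 0) :
    QesOp (P := P) hd w k f p = Real.sqrt w * QestarIter hd k (fun q => f q) p := rfl

/-- **The exponent of (4.2.1) on the torus**: `‖curlOp w c A − QesOp f‖² = Σ_p η^d|(∂A)(p) − (Q^{e*}_kf)(p)|²`, the printed
`‖∂A − Q^{e*}_kf‖²` in the η-lattice norm (2.20) (`w = η^d ≥ 0`). [cite: BalabanImbrieJaffe1985, (4.2.1) p.310] -/
theorem norm_sq_curlOp_sub_QesOp (hd : 2 ≤ P.d) {w : ℝ} (hw : 0 ≤ w) (c : ℝ) (k : ℕ) (v : BondSpace P)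
    (f : UnitPlaqSpace P k) :
    ‖curlOp (P := P) w c v - QesOp (P := P) hd w k f‖ ^ 2 =
      ∑ p : Plaq P 0, w * (curl c ((toE P).symm v) p - QestarIter hd k (fun q => f q) p) ^ 2 := by
  rw [EuclideanSpace.norm_sq_eq]
  refine Finset.sum_congr rfl fun p _ => ?_
  rw [Real.norm_eq_abs, sq_abs]
  show (curlOp (P := P) w c v p - QesOp (P := P) hd w k f p) ^ 2 = _
  rw [curlOp_apply', QesOp_apply, ← mul_sub, mul_pow, Real.sq_sqrt hw]

/-! ## 2. σ_k on the torus and (4.2.1) -/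

/-- **σ_k ON THE TORUS** — (4.2.2) `σ_k = Q^e_k(I − ∂G_{k,Ax}∂^*)Q^{e*}_k` (p09's `sigmaOp`) at the torus data: constraint subspace
`δ(Q_kA)δ_{k,Ax}(A)` = `V411 P k`, curl `curlOp w c`, `Q^{e*}_k` = `QesOp hd w k`. [cite: BalabanImbrieJaffe1985, (4.2.2) p.310] -/
noncomputable def sigmaTorus (hd : 2 ≤ P.d) (w c : ℝ) (k : ℕ) : UnitPlaqSpace P k →ₗ[ℝ] UnitPlaqSpace P k :=
  sigmaOp (V411 P k) (curlOp (P := P) w c) (QesOp (P := P) hd w k)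

/-- **(4.2.1) ON THE TORUS**, verbatim: *"exp(−½⟨f, σ_kf⟩) = Z_{k,Ax}^{−1}∫𝒟Aδ(Q_kA)δ_{k,Ax}(A)exp(−½‖∂A − Q^{e*}_kf‖²). (4.2.1)"*
— PROVED for `sigmaTorus` (p09's `isSigmaForm_sigmaOp` at the torus data; `w > 0`, no zero modes `hD` as on p. 309).
[cite: BalabanImbrieJaffe1985, (4.2.1) p.310] -/
theorem isSigmaForm_sigmaTorus (hd : 2 ≤ P.d) {w : ℝ} (hw : 0 < w) (c : ℝ) (k : ℕ)
    (hD : ∀ A : VecField P 0 ℝ, A ∈ (constraint411 k : Submodule ℝ (VecField P 0 ℝ)) → (∀ p, curl c A p = 0) → A = 0) :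
    IsSigmaForm (V411 P k) (curlOp (P := P) w c) (QesOp (P := P) hd w k) (sigmaTorus (P := P) hd w c k) :=
  isSigmaForm_sigmaOp (noZeroModes_V411 hw c k hD) _

/-- `0 ≤ ⟨f, σ_kf⟩ ≤ ‖Q^{e*}_kf‖²_η` on the torus (p09's `sigmaOp_form_bounds`). [cite: BalabanImbrieJaffe1985, (4.2.7) p.311] -/
theorem sigmaTorus_form_bounds (hd : 2 ≤ P.d) {w : ℝ} (hw : 0 < w) (c : ℝ) (k : ℕ)
    (hD : ∀ A : VecField P 0 ℝ, A ∈ (constraint411 k : Submodule ℝ (VecField P 0 ℝ)) → (∀ p, curl c A p = 0) → A = 0)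
    (f : UnitPlaqSpace P k) :
    0 ≤ ⟪f, sigmaTorus (P := P) hd w c k f⟫ ∧ ⟪f, sigmaTorus (P := P) hd w c k f⟫ ≤ ‖QesOp (P := P) hd w k f‖ ^ 2 :=
  sigmaOp_form_bounds (noZeroModes_V411 hw c k hD) _ f

/-! ## 3. (4.3.1)–(4.3.2) on the torus: σ_k on curls, with the printed representative `Q^{s*}_kB` -/

/-- **The translation datum of (4.3.2) DISCHARGED**: for the representative `A₀ = Q^{s*}_kB` of the class of `B` and the unit-lattice
curl `f₀ = ∂B` (factor `c/L^k` against the fine factor `c`), `Q^{e*}_kf₀ = ∂A₀` in p09's encoding — *"we use ∂Q^{s*}_k = Q^{e*}_k∂"*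
(`BIJ85Eq531Inputs.curl_QsstarIter`). [cite: BalabanImbrieJaffe1985, (4.3.2) p.311] -/
theorem QesOp_curl_eq (hd : 2 ≤ P.d) {k : ℕ} (hk : k ≤ P.m + P.K) (w c : ℝ) (B : PBond P k → ℝ) :
    QesOp (P := P) hd w k (toU P k (curl (c / (P.L : ℝ) ^ k) B)) = curlOp (P := P) w c (toE P (QsstarIter k B)) := by
  ext p
  rw [QesOp_apply, curlOp_apply', LinearEquiv.symm_apply_apply, curl_QsstarIter_div hd hk c B]
  rfl

/-- **(4.3.1)–(4.3.2) ON THE TORUS**: *"⟨∂B, σ_k∂B⟩ = ⟨B, Δ_kB⟩ (4.3.1) … exp(−½⟨∂B, σ_k∂B⟩) = … = Z_{k,Ax}^{−1}∫𝒟Aδ(Q_kA − B)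
δ_{k,Ax}(A)exp(−½‖∂A‖²) = exp(−½⟨B, Δ_kB⟩) (4.3.2)"* — for `sigmaTorus` at the unit-lattice curl `f₀ = ∂B` the form equals the
curl energy `‖∂H_{k,Ax}B‖²_η = Σ_pη^d|(∂H_{k,Ax}B)(p)|² = 2·curlAction w c (H_{k,Ax}B)` of the axial minimizer of the class
`{Q_kA = B, δ_{k,Ax}(A)}`, `H_{k,Ax}B = torusHax w c k (Q^{s*}_kB)` — p09's `sigma_curl_eq_min_energy` with its hypothesis supplied
by `QesOp_curl_eq` (the printed translation `A → A + Q^{s*}_kB`, `∂Q^{s*}_k = Q^{e*}_k∂`, (2.19)); `w > 0`, no zero modes, standing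
range, `2 ≤ d`. [cite: BalabanImbrieJaffe1985, (4.3.2) p.311] -/
theorem sigmaTorus_curl (hd : 2 ≤ P.d) {k : ℕ} (hk : k ≤ P.m + P.K) {w : ℝ} (hw : 0 < w) (c : ℝ)
    (hD : ∀ A : VecField P 0 ℝ, A ∈ (constraint411 k : Submodule ℝ (VecField P 0 ℝ)) → (∀ p, curl c A p = 0) → A = 0)
    (B : PBond P k → ℝ) :
    ⟪toU P k (curl (c / (P.L : ℝ) ^ k) B), sigmaTorus (P := P) hd w c k (toU P k (curl (c / (P.L : ℝ) ^ k) B))⟫ =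
      2 * curlAction w c (torusHax w c k (QsstarIter k B)) := by
  have hD' := noZeroModes_V411 hw c k hD
  rw [sigmaTorus, sigma_curl_eq_min_energy hD' (isSigmaForm_sigmaOp hD' _) (QesOp_curl_eq hd hk w c B)]
  have h := half_norm_curlOp_sq hw.le c (Hax (V411 P k) (curlOp (P := P) w c) (toE P (QsstarIter k B)))
  have h2 : (toE P).symm (Hax (V411 P k) (curlOp (P := P) w c) (toE P (QsstarIter k B))) =
      torusHax w c k (QsstarIter k B) := rfl
  rw [h2] at h
  linarith

/-- **(4.3.2), the bound it implies**: `⟨∂B, σ_k∂B⟩ ≤ Σ_pη^d|(∂A)(p)|² = 2·curlAction w c A` for EVERY `A` with `Q_kA = B` and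
`δ_{k,Ax}(A)` (the minimizer minimizes; p09's `sigmaOp_curl_le` with the translation `A − Q^{s*}_kB ∈ δ(Q_kA′)δ_{k,Ax}(A′)` of
`BIJ85Eq531Inputs.sub_QsstarIter_mem_constraint411`). [cite: BalabanImbrieJaffe1985, (4.3.2) p.311] -/
theorem sigmaTorus_curl_le (hd : 2 ≤ P.d) {k : ℕ} (hk : k ≤ P.m + P.K) {w : ℝ} (hw : 0 < w) (c : ℝ)
    (hD : ∀ A : VecField P 0 ℝ, A ∈ (constraint411 k : Submodule ℝ (VecField P 0 ℝ)) → (∀ p, curl c A p = 0) → A = 0)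
    (B : PBond P k → ℝ) {A : VecField P 0 ℝ} (hQ : bondAvgIter k A = B) (hAx : deltaAx k A) :
    ⟪toU P k (curl (c / (P.L : ℝ) ^ k) B), sigmaTorus (P := P) hd w c k (toU P k (curl (c / (P.L : ℝ) ^ k) B))⟫ ≤
      2 * curlAction w c A := by
  have hD' := noZeroModes_V411 hw c k hD
  have hA : toE P A - toE P (QsstarIter k B) ∈ V411 P k := by
    rw [← map_sub]
    exact Submodule.mem_map_of_mem (sub_QsstarIter_mem_constraint411 hk hQ hAx)
  have h := sigmaOp_curl_le hD' (QesOp (P := P) hd w k) (QesOp_curl_eq hd hk w c B) hA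
  have h3 := half_norm_curlOp_sq hw.le c (toE P A)
  rw [LinearEquiv.symm_apply_apply] at h3
  show ⟪toU P k (curl (c / (P.L : ℝ) ^ k) B),
      sigmaOp (V411 P k) (curlOp (P := P) w c) (QesOp (P := P) hd w k) (toU P k (curl (c / (P.L : ℝ) ^ k) B))⟫ ≤ _
  linarith

/-- **`⟨B, Δ_kB⟩` on the torus** — the action Δ_k that (4.3.1) *"⟨∂B, σ_k∂B⟩ = ⟨B, Δ_kB⟩, (4.3.1) which defines an action Δ_k"*
names, given by the right member of (4.3.2): the minimal curl energy `Σ_pη^d|(∂H_{k,Ax}B)(p)|²` of the class `{Q_kA = B, δ_{k,Ax}(A)}`.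
[cite: BalabanImbrieJaffe1985, (4.3.1) p.311] -/
noncomputable def deltaTorus (w c : ℝ) (k : ℕ) (B : PBond P k → ℝ) : ℝ :=
  2 * curlAction w c (torusHax w c k (QsstarIter k B))

/-- **(4.3.1) ON THE TORUS**: `⟨∂B, σ_k∂B⟩ = ⟨B, Δ_kB⟩` for `sigmaTorus` and `deltaTorus` (restating `sigmaTorus_curl`).
[cite: BalabanImbrieJaffe1985, (4.3.1) p.311] -/
theorem sigmaTorus_curl_eq_deltaTorus (hd : 2 ≤ P.d) {k : ℕ} (hk : k ≤ P.m + P.K) {w : ℝ} (hw : 0 < w) (c : ℝ)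
    (hD : ∀ A : VecField P 0 ℝ, A ∈ (constraint411 k : Submodule ℝ (VecField P 0 ℝ)) → (∀ p, curl c A p = 0) → A = 0)
    (B : PBond P k → ℝ) :
    ⟪toU P k (curl (c / (P.L : ℝ) ^ k) B), sigmaTorus (P := P) hd w c k (toU P k (curl (c / (P.L : ℝ) ^ k) B))⟫ =
      deltaTorus w c k B :=
  sigmaTorus_curl hd hk hw c hD B

/-- `0 ≤ ⟨B, Δ_kB⟩` on the torus (`w ≥ 0`). [cite: BalabanImbrieJaffe1985, (4.3.1) p.311] -/
theorem deltaTorus_nonneg {w : ℝ} (hw : 0 ≤ w) (c : ℝ) (k : ℕ) (B : PBond P k → ℝ) : 0 ≤ deltaTorus w c k B :=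
  mul_nonneg (by norm_num) (curlAction_nonneg hw c _)

end Literature.MathematicalPhysics.QuantumFieldTheory.BalabanImbrieJaffe1984to88.BIJ85Sigma421Torus
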